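import Literature.NumberTheory.LFunctions.KMVSecondMainTermFloorMasses
import Literature.NumberTheory.LFunctions.KowalskiMichelPeterssonFormula
import Literature.NumberTheory.LFunctions.IwaniecSarnakFamilyWeightTwoPetersson
import Literature.NumberTheory.LFunctions.KMVMollifierDiagonalMainTerm
import Literature.NumberTheory.LFunctions.KMVDiagonalSlack

/-!
# Route `PrimeLevelFamEdge`, crux K_B `BeyondDiagonalBeatsQuarter` (stmt-Parity-20343), line `birth`:
# the Cauchy–Schwarz floor of the second main term RE-THREADED over the in-range Petersson bound
# (`kowalskiMichel2000_peterssonBound`, R2-G44 repair)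

`Theorems/BeyondDiagonalBeatsQuarter/SecondMainTermFloor.lean` (p525223) records, modulo two printed
facts, that the positivity half of the line's old stub S2 is a theorem (`4 ≤ second + T₂` at `X²`
below length `2`), that the value of every profile is `≤ ½`, and that S2 reduces to its upper
conjunct / to the band `T₂ Δ' X² 1 < 4(Δ'−1)/Δ'`. One of its two displayed facts,
`KowalskiMichel2000.kowalskiMichel2000_petersson` (the Petersson–Weil display of [KowalskiMichel2000,
§2.3 p. 310] typed for ALL `m, n ≥ 1`), is REFUTED AS TYPED (cell record R2-G44, 2026-08-27: at
`(m,n) = (q,q)`, `λ_f(q)² = 1/q` on `H₂(q)`; tree theorems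
`KowalskiMichel2000.not_kowalskiMichel2000_petersson`, p528813, and
`Theorems.PeterssonPrinted.Negative.kowalskiMichel2000_petersson_false_allIndices`, p528704), so those
six theorems are VACUOUS AS TYPED. Print is fine: the display is used only where `q` does not divide
both indices, and the repaired fact `KowalskiMichel2000.kowalskiMichel2000_peterssonBound` (p528813;
binder `¬ (q ∣ m ∧ q ∣ n)`) is what the chain ever needed — at `(1,1)` (total harmonic mass `→ 1`)
and `(q,1)` (parity balance `2·even − total → 0`). This file re-lands the six theorems over the
repaired fact, with NEW names (suffix `_pb`), through the masses form of the floor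
(`KMV2000.sq_firstMainTerm_le_secondMainTerm_of_lt_two_of_masses`, Literature
`KMVSecondMainTermFloorMasses`): §1 derives the two harmonic-mass bounds from the repaired fact
(the proofs of `CentralValueFamilyHalfEdge.abs_totalMass_sub_one_le` /
`abs_two_mul_evenMass_sub_totalMass_le` with the one extra side goal `q ∤ 1`); §2 the floor at `X²`
and its corollaries; §3 the two reductions of the old S2 signature. No ex-falso use of the refuted
fact anywhere (smuggling rule); no Theses statement is asserted; helper for the crux item; standard
axioms. «The programme SEARCHES and TYPES; no claim about Landau–Siegel zeros, Theorems 1–2 of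
arXiv:2211.02515 or a repaired Margin232 until a kernel theorem says so.»
-/

noncomputable section

namespace Summit.Parity.GeneralizedHardyLittlewood.Theorems.BeyondDiagonalBeatsQuarter

open Polynomial
open Literature.NumberTheory.LFunctions
open Literature.NumberTheory.LFunctions.IwaniecSarnak
open Literature.NumberTheory.LFunctions.CentralValueFamilyHalfEdge

/-! ## §1. The two harmonic-mass bounds from the in-range Petersson bound (`(1,1)` and `(q,1)`) -/

/-- **Total harmonic mass at prime level, weight `2`**, from the in-range Petersson bound at
`(m,n) = (1,1)` (`q ∤ 1`): `|Σʰ_{H₂(q)} 1 − 1| ≤ C·q^{−3/2}` for every prime `q`.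
[cite: KowalskiMichel2000, §2.3 p. 310 (display after (16)) and §2.4.2 (23)] -/
theorem abs_totalMass_sub_one_le_pb (hP : KowalskiMichel2000.kowalskiMichel2000_peterssonBound) :
    ∃ C : ℝ, ∀ (q : ℕ) [NeZero q], q.Prime →
      |harmonicSum q 2 (fun _ => (1 : ℝ)) - 1| ≤ C * (q : ℝ) ^ (-(3 / 2 : ℝ)) := by
  obtain ⟨C, hC⟩ := hP 1 one_pos
  refine ⟨C, fun q _ hq => ?_⟩
  have h := hC q hq 1 1 le_rfl le_rfl (fun hdvd => hq.not_dvd_one hdvd.1)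
  rw [pet_one_one, if_pos rfl] at h
  have e : (((harmonicSum q 2 (fun _ => (1 : ℝ)) : ℝ) : ℂ) - 1) =
      (((harmonicSum q 2 (fun _ => (1 : ℝ)) - 1 : ℝ)) : ℂ) := by push_cast; ring
  rw [e, Complex.norm_real, Real.norm_eq_abs] at h
  simpa using h

/-- **The root-number sum is small**, from the in-range Petersson bound at `(m,n) = (q,1)` (`q ∤ 1`),
`ε = ¼`: `|2·Σʰ_{w_f=1} 1 − Σʰ 1| ≤ C·q^{−1/4}` over `H₂(q)` for every prime `q`
(`2·even = total + q^{1/2}·pet(q,1)`, `CentralValueFamilyHalfEdge.two_mul_evenMass_eq_weightTwo`).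
[cite: KowalskiMichel2000, §2.3 p. 310 (display after (16)) and §2.4.2 (23)]
[cite: IwaniecKowalski2004, (14.62)] -/
theorem abs_two_mul_evenMass_sub_totalMass_le_pb
    (hP : KowalskiMichel2000.kowalskiMichel2000_peterssonBound) :
    ∃ C : ℝ, ∀ (q : ℕ) [NeZero q], q.Prime →
      |2 * harmonicSum q 2 (fun f => if rootNumber f = 1 then (1 : ℝ) else 0) -
          harmonicSum q 2 (fun _ => (1 : ℝ))| ≤ C * (q : ℝ) ^ (-(1 / 4 : ℝ)) := by
  obtain ⟨C, hC⟩ := hP (1 / 4) (by norm_num)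
  refine ⟨C, fun q _ hq => ?_⟩
  have h := hC q hq q 1 hq.one_lt.le le_rfl (fun hdvd => hq.not_dvd_one hdvd.2)
  rw [if_neg hq.one_lt.ne', sub_zero] at h
  have hqpos : (0 : ℝ) < q := by exact_mod_cast hq.pos
  have hid := two_mul_evenMass_eq_weightTwo q hq
  have e : ((2 * harmonicSum q 2 (fun f => if rootNumber f = 1 then (1 : ℝ) else 0) -
      harmonicSum q 2 (fun _ => (1 : ℝ)) : ℝ) : ℂ) =
      (Real.sqrt q : ℂ) * KowalskiMichel2000.pet q q 1 := by
    push_cast at hid ⊢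
    rw [hid]; ring
  rw [← Real.norm_eq_abs, ← Complex.norm_real, e, norm_mul, Complex.norm_real, Real.norm_eq_abs,
    abs_of_nonneg (Real.sqrt_nonneg _)]
  have hrhs : Real.sqrt q * (C * (((q : ℝ) * (1 : ℕ)) ^ (1 / 2 + 1 / 4 : ℝ)) *
      (q : ℝ) ^ (-(3 / 2 : ℝ))) = C * (q : ℝ) ^ (-(1 / 4 : ℝ)) := by
    rw [Nat.cast_one, mul_one, Real.sqrt_eq_rpow]
    have : (q : ℝ) ^ (1 / 2 : ℝ) * ((q : ℝ) ^ (1 / 2 + 1 / 4 : ℝ) * (q : ℝ) ^ (-(3 / 2 : ℝ))) =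
        (q : ℝ) ^ (-(1 / 4 : ℝ)) := by
      rw [← Real.rpow_add hqpos, ← Real.rpow_add hqpos]; norm_num
    calc (q : ℝ) ^ (1 / 2 : ℝ) * (C * (q : ℝ) ^ (1 / 2 + 1 / 4 : ℝ) * (q : ℝ) ^ (-(3 / 2 : ℝ)))
        = C * ((q : ℝ) ^ (1 / 2 : ℝ) * ((q : ℝ) ^ (1 / 2 + 1 / 4 : ℝ) *
            (q : ℝ) ^ (-(3 / 2 : ℝ)))) := by ring
      _ = C * (q : ℝ) ^ (-(1 / 4 : ℝ)) := by rw [this]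
  rw [← hrhs]
  exact mul_le_mul_of_nonneg_left h (Real.sqrt_nonneg _)

/-- The two harmonic-mass bounds in the exponent-free shape consumed by
`KMV2000.sq_firstMainTerm_le_secondMainTerm_of_masses` (exponents `3/2` and `1/4`).
[cite: KowalskiMichel2000, §2.3 p. 310 (display after (16)) and §2.4.2 (23)] -/
theorem masses_pb (hP : KowalskiMichel2000.kowalskiMichel2000_peterssonBound) :
    (∃ C a : ℝ, 0 < a ∧ ∀ (q : ℕ) [NeZero q], q.Prime →
      |harmonicSum q 2 (fun _ ↦ (1 : ℝ)) - 1| ≤ C * (q : ℝ) ^ (-a)) ∧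
    (∃ C a : ℝ, 0 < a ∧ ∀ (q : ℕ) [NeZero q], q.Prime →
      |2 * harmonicSum q 2 (fun f ↦ if rootNumber f = 1 then (1 : ℝ) else 0) -
          harmonicSum q 2 (fun _ ↦ (1 : ℝ))| ≤ C * (q : ℝ) ^ (-a)) := by
  obtain ⟨Ct, Ht⟩ := abs_totalMass_sub_one_le_pb hP
  obtain ⟨Ce, He⟩ := abs_two_mul_evenMass_sub_totalMass_le_pb hP
  exact ⟨⟨Ct, 3 / 2, by norm_num, fun q _ hq ↦ Ht q hq⟩, ⟨Ce, 1 / 4, by norm_num, fun q _ hq ↦ He q hq⟩⟩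

/-! ## §2. The floor at `X²` below length `2`, and the value ceiling `½` -/

/-- **The positivity conjunct of the old S2, with room to spare** (re-threaded). Under Bettin's twisted
first moment (`T₁ Δ' X² 1 = 0` below length `2`) and the in-range Petersson bound: for every window
`(1, Δ]`, every MA-consistent `(T₁, T₂)` and every `1 < Δ' < min Δ 2`,
`4 ≤ secondMomentForm Δ' X² 1 + T₂ Δ' X² 1` (Cauchy–Schwarz floor `(lin + T₁)² ≤ second + T₂`,
`lin = 2`). [cite: Bettin2017, Thm. 1.1] [cite: KowalskiMichelVanderKam2000, §2 p. 6 and §6 p. 19] -/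
theorem four_le_secondMainTerm_X_sq_of_bettin_pb (hB : bettin2017_theorem11_primeLevel)
    (hP : KowalskiMichel2000.kowalskiMichel2000_peterssonBound) :
    ∀ Δ : ℝ, 1 < Δ → ∀ T₁ T₂ : ℝ → ℝ[X] → ℝ[X] → ℝ, KMV2000.MomentAsymptotics 1 Δ T₁ T₂ →
      ∀ Δ' : ℝ, 1 < Δ' → Δ' < min Δ 2 →
        4 ≤ KMV2000.secondMomentForm Δ' (X ^ 2) 1 + T₂ Δ' (X ^ 2) 1 := by
  intro Δ _ T₁ T₂ hMA Δ' h1 h2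
  have hT₁ : T₁ Δ' (X ^ 2) 1 = 0 :=
    KMV2000.T₁_apply_one_eq_zero_of_bettin hB KMV2000.admissible_X_sq hMA h1 h2
  obtain ⟨Ht, He⟩ := masses_pb hP
  have h := KMV2000.sq_firstMainTerm_le_secondMainTerm_of_lt_two_of_masses Ht He hMA
    KMV2000.admissible_X_sq (by linarith) (lt_of_lt_of_le h2 (min_le_right _ _)) h1
    (lt_of_lt_of_le h2 (min_le_left _ _)).le
  rw [hT₁, add_zero, KMV2000.linForm_X_sq_one] at h
  norm_num at h
  exact h

/-- The positivity conjunct of the old S2 on the whole window `(1, min Δ 2)` (re-threaded):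
`0 < secondMomentForm Δ' X² 1 + T₂ Δ' X² 1`. [cite: Bettin2017, Thm. 1.1]
[cite: KowalskiMichelVanderKam2000, §6 p. 19] -/
theorem secondMainTerm_X_sq_pos_of_bettin_pb (hB : bettin2017_theorem11_primeLevel)
    (hP : KowalskiMichel2000.kowalskiMichel2000_peterssonBound) :
    ∀ Δ : ℝ, 1 < Δ → ∀ T₁ T₂ : ℝ → ℝ[X] → ℝ[X] → ℝ, KMV2000.MomentAsymptotics 1 Δ T₁ T₂ →
      ∀ Δ' : ℝ, 1 < Δ' → Δ' < min Δ 2 →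
        0 < KMV2000.secondMomentForm Δ' (X ^ 2) 1 + T₂ Δ' (X ^ 2) 1 :=
  fun Δ hΔ T₁ T₂ hMA Δ' h1 h2 ↦ lt_of_lt_of_le (by norm_num)
    (four_le_secondMainTerm_X_sq_of_bettin_pb hB hP Δ hΔ T₁ T₂ hMA Δ' h1 h2)

/-- The floor as a bound on the off-diagonal main term itself (re-threaded): `−4/Δ' ≤ T₂ Δ' X² 1` for
`1 < Δ' < min Δ 2` (`secondMomentForm Δ' X² 1 = 4 + 4/Δ'`). [cite: Bettin2017, Thm. 1.1]
[cite: KowalskiMichelVanderKam2000, §6 p. 19] -/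
theorem neg_four_div_le_T₂_X_sq_of_bettin_pb (hB : bettin2017_theorem11_primeLevel)
    (hP : KowalskiMichel2000.kowalskiMichel2000_peterssonBound) :
    ∀ Δ : ℝ, 1 < Δ → ∀ T₁ T₂ : ℝ → ℝ[X] → ℝ[X] → ℝ, KMV2000.MomentAsymptotics 1 Δ T₁ T₂ →
      ∀ Δ' : ℝ, 1 < Δ' → Δ' < min Δ 2 → -4 / Δ' ≤ T₂ Δ' (X ^ 2) 1 := by
  intro Δ hΔ T₁ T₂ hMA Δ' h1 h2
  have h := four_le_secondMainTerm_X_sq_of_bettin_pb hB hP Δ hΔ T₁ T₂ hMA Δ' h1 h2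
  rw [KMV2000.secondMomentForm_X_sq_one] at h
  have hΔ' : 0 < Δ' := by linarith
  rw [neg_div, neg_le_iff_add_nonneg]
  linarith

/-- **The value ceiling on the window, every profile** (re-threaded). Under the in-range Petersson
bound alone: for every window `(1, Δ]`, every MA-consistent `(T₁, T₂)`, every admissible `P` and
every `1 < Δ' ≤ Δ` with `Δ' < 2`, the Cauchy–Schwarz value is `≤ ½`.
[cite: KowalskiMichelVanderKam2000, §2 p. 6] [cite: IwaniecConversations2006, §7 p. 97] -/
theorem value_le_half_pb (hP : KowalskiMichel2000.kowalskiMichel2000_peterssonBound) :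
    ∀ Δ : ℝ, 1 < Δ → ∀ T₁ T₂ : ℝ → ℝ[X] → ℝ[X] → ℝ, KMV2000.MomentAsymptotics 1 Δ T₁ T₂ →
      ∀ P : ℝ[X], KMV2000.Admissible P → ∀ Δ' : ℝ, 1 < Δ' → Δ' ≤ Δ → Δ' < 2 →
        (KMV2000.linForm Δ' P 1 + T₁ Δ' P 1) ^ 2 /
            (2 * (KMV2000.secondMomentForm Δ' P 1 + T₂ Δ' P 1)) ≤ 1 / 2 := by
  intro _ _ _ _ hMA _ hPadm _ h1 h2 h3
  obtain ⟨Ht, He⟩ := masses_pb hP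
  exact KMV2000.value_le_half_of_masses Ht He hMA hPadm (by linarith) h1 h2
    (KMV2000.goodPrimesUnbounded_of_lt_two (by linarith) h3)

/-! ## §3. The two reductions of the old S2 signature (upper conjunct; band form) -/

/-- **S2 reduces to its upper conjunct** (re-threaded): modulo Bettin and the in-range Petersson
bound, `0 < second + T₂ ∧ second + T₂ < 2·lin²` at `X²` on some sub-window follows from the UPPER
inequality alone there. [cite: Bettin2017, Thm. 1.1] [cite: KowalskiMichelVanderKam2000, §6 p. 19] -/
theorem secondCorrectionBelowSlackSomewhere_of_upper_pb (hB : bettin2017_theorem11_primeLevel)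
    (hP : KowalskiMichel2000.kowalskiMichel2000_peterssonBound)
    (hU : ∀ Δ : ℝ, 1 < Δ → ∀ T₁ T₂ : ℝ → ℝ[X] → ℝ[X] → ℝ, KMV2000.MomentAsymptotics 1 Δ T₁ T₂ →
      ∃ a b : ℝ, 1 ≤ a ∧ a < b ∧ b ≤ min Δ 2 ∧ a < 3 / 2 ∧ ∀ Δ' : ℝ, a < Δ' → Δ' < b →
        KMV2000.secondMomentForm Δ' (X ^ 2) 1 + T₂ Δ' (X ^ 2) 1 <
          2 * KMV2000.linForm Δ' (X ^ 2) 1 ^ 2) :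
    ∀ Δ : ℝ, 1 < Δ → ∀ T₁ T₂ : ℝ → ℝ[X] → ℝ[X] → ℝ, KMV2000.MomentAsymptotics 1 Δ T₁ T₂ →
      ∃ a b : ℝ, 1 ≤ a ∧ a < b ∧ b ≤ min Δ 2 ∧ a < 3 / 2 ∧ ∀ Δ' : ℝ, a < Δ' → Δ' < b →
        0 < KMV2000.secondMomentForm Δ' (X ^ 2) 1 + T₂ Δ' (X ^ 2) 1 ∧
          KMV2000.secondMomentForm Δ' (X ^ 2) 1 + T₂ Δ' (X ^ 2) 1 <
            2 * KMV2000.linForm Δ' (X ^ 2) 1 ^ 2 := by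
  intro Δ hΔ T₁ T₂ hMA
  obtain ⟨a, b, ha, hab, hb, ha32, hval⟩ := hU Δ hΔ T₁ T₂ hMA
  exact ⟨a, b, ha, hab, hb, ha32, fun Δ' h1' h2' ↦
    ⟨secondMainTerm_X_sq_pos_of_bettin_pb hB hP Δ hΔ T₁ T₂ hMA Δ'
      (lt_of_le_of_lt ha h1') (lt_of_lt_of_le h2' hb), hval Δ' h1' h2'⟩⟩

/-- **S2 in band form** (re-threaded): modulo Bettin and the in-range Petersson bound, the old S2
signature follows from `T₂ Δ' X² 1 < 4(Δ' − 1)/Δ'` on some sub-window `(a, b) ⊆ [1, min Δ 2]`,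
`a < 3/2`. [cite: Bettin2017, Thm. 1.1] [cite: KowalskiMichelVanderKam2000, §6 p. 19 and (30)–(32)] -/
theorem secondCorrectionBelowSlackSomewhere_of_T₂_band_pb (hB : bettin2017_theorem11_primeLevel)
    (hP : KowalskiMichel2000.kowalskiMichel2000_peterssonBound)
    (hBand : ∀ Δ : ℝ, 1 < Δ → ∀ T₁ T₂ : ℝ → ℝ[X] → ℝ[X] → ℝ, KMV2000.MomentAsymptotics 1 Δ T₁ T₂ →
      ∃ a b : ℝ, 1 ≤ a ∧ a < b ∧ b ≤ min Δ 2 ∧ a < 3 / 2 ∧ ∀ Δ' : ℝ, a < Δ' → Δ' < b →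
        T₂ Δ' (X ^ 2) 1 < 4 * (Δ' - 1) / Δ') :
    ∀ Δ : ℝ, 1 < Δ → ∀ T₁ T₂ : ℝ → ℝ[X] → ℝ[X] → ℝ, KMV2000.MomentAsymptotics 1 Δ T₁ T₂ →
      ∃ a b : ℝ, 1 ≤ a ∧ a < b ∧ b ≤ min Δ 2 ∧ a < 3 / 2 ∧ ∀ Δ' : ℝ, a < Δ' → Δ' < b →
        0 < KMV2000.secondMomentForm Δ' (X ^ 2) 1 + T₂ Δ' (X ^ 2) 1 ∧
          KMV2000.secondMomentForm Δ' (X ^ 2) 1 + T₂ Δ' (X ^ 2) 1 <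
            2 * KMV2000.linForm Δ' (X ^ 2) 1 ^ 2 := by
  refine secondCorrectionBelowSlackSomewhere_of_upper_pb hB hP fun Δ hΔ T₁ T₂ hMA ↦ ?_
  obtain ⟨a, b, ha, hab, hb, ha32, hval⟩ := hBand Δ hΔ T₁ T₂ hMA
  refine ⟨a, b, ha, hab, hb, ha32, fun Δ' h1' h2' ↦ ?_⟩
  have hΔ' : 0 < Δ' := by linarith
  have h := hval Δ' h1' h2'
  rw [KMV2000.secondMomentForm_X_sq_one, KMV2000.linForm_X_sq_one]
  rw [lt_div_iff₀ hΔ'] at h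
  have key : 4 / Δ' < 4 - T₂ Δ' (X ^ 2) 1 := by
    rw [div_lt_iff₀ hΔ', sub_mul]
    linarith
  have e8 : (2 : ℝ) * 2 ^ 2 = 8 := by norm_num
  rw [e8]
  linarith

end Summit.Parity.GeneralizedHardyLittlewood.Theorems.BeyondDiagonalBeatsQuarter
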